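import Mathlib
import Summits.Langlands.Langlands.Theorems.CapacityClassicalityHilbertIntegralOverconvergentIsCongruenceStubFiniteSlashOrbit

/-!
# Transfer (abstract half): algebraic over modular forms ⇒ fixed by a congruence subgroup

Stub `stub_transferAbstract` (S12) for the crux `HilbertIntegralOverconvergentIsCongruence`
(line Sketch-ideate-r1-k1), the TRANSFER half modulo vocabulary. `G = SL₂(𝓞_F)` acts on a
commutative domain `L` by ring automorphisms (`MulSemiringAction`), `J : 𝓦 → G → Lˣ` are automorphy
factors, additive in the weight and satisfying the cocycle identity
`J b (γ γ') = J b γ · γ • J b γ'`; the weight-`k` slash operation is `γ ⋆ f := (J k γ)⁻¹ · γ • f`.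

* `transferAbs_val_J_one`, `transferAbs_slash_one`, `transferAbs_slash_mul`: the cocycle identity
  makes `⋆` an action (`1 ⋆ f = f`, `(γ γ') ⋆ f = γ ⋆ (γ' ⋆ f)`).
* `transferAbs_exists_finiteIndex`: if `g` satisfies a non-trivial polynomial relation whose
  coefficients are modular forms for a finite-index `Γ ≤ G` (weights `b_j` with `b_j + j • k = b_0`),
  then the stabiliser `{γ ∈ Γ | γ ⋆ g = g}` is a finite-index subgroup of `G`: it is a subgroup by
  the action laws, and `Γ ⧸ stabiliser` injects (`[γ] ↦ γ ⋆ g`) into the weight-`k` orbit of `g`,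
  which is finite by `stub_finiteSlashOrbit` (S9).
* `stub_transferAbstract`: combine with the congruence subgroup property (hypothesis `hCSP`) to get
  a non-zero ideal `𝔪` with `Γ(𝔪)` fixing `g` under `⋆`.
-/

set_option linter.dupNamespace false

namespace Summit.Langlands.Langlands.Theorems.HilbertIntegralOverconvergentIsCongruence

/-- The cocycle identity `J b (γ γ') = J b γ · γ • J b γ'` forces `J b 1 = 1` (take `γ = γ' = 1`
and cancel the unit `J b 1`). -/
theorem transferAbs_val_J_one {G L 𝓦 : Type*} [Group G] [CommRing L] [MulSemiringAction G L]
    (J : 𝓦 → G → Lˣ)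
    (hJcoc : ∀ (b : 𝓦) (γ γ' : G), (J b (γ * γ') : L) = J b γ * γ • (J b γ' : L)) (b : 𝓦) :
    (J b 1 : L) = 1 := by
  have h := hJcoc b 1 1
  rw [one_smul, mul_one] at h
  exact (Units.mul_right_inj (J b 1)).mp (by rw [mul_one]; exact h.symm)

/-- Unit law of the weight-`k` slash operation: `1 ⋆ f = (J k 1)⁻¹ · 1 • f = f`. -/
theorem transferAbs_slash_one {G L 𝓦 : Type*} [Group G] [CommRing L] [MulSemiringAction G L]
    (J : 𝓦 → G → Lˣ)
    (hJcoc : ∀ (b : 𝓦) (γ γ' : G), (J b (γ * γ') : L) = J b γ * γ • (J b γ' : L)) (k : 𝓦)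
    (f : L) : ((J k 1)⁻¹ : Lˣ) * (1 : G) • f = f := by
  have hu : J k 1 = 1 := Units.val_eq_one.mp (transferAbs_val_J_one J hJcoc k)
  rw [hu, inv_one, Units.val_one, one_mul, one_smul]

/-- Multiplication law of the weight-`k` slash operation `γ ⋆ f := (J k γ)⁻¹ · γ • f`:
`(γ γ') ⋆ f = γ ⋆ (γ' ⋆ f)`, from the cocycle identity `J k (γ γ') = J k γ · γ • J k γ'`
(multiply both sides by the unit `J k (γ γ')` and use that `γ` acts by ring homomorphisms). -/
theorem transferAbs_slash_mul {G L 𝓦 : Type*} [Group G] [CommRing L] [MulSemiringAction G L]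
    (J : 𝓦 → G → Lˣ)
    (hJcoc : ∀ (b : 𝓦) (γ γ' : G), (J b (γ * γ') : L) = J b γ * γ • (J b γ' : L)) (k : 𝓦)
    (γ γ' : G) (f : L) :
    ((J k (γ * γ'))⁻¹ : Lˣ) * (γ * γ') • f
      = ((J k γ)⁻¹ : Lˣ) * γ • (((J k γ')⁻¹ : Lˣ) * γ' • f) := by
  rw [← Units.mul_right_inj (J k (γ * γ'))]
  have e1 : (J k γ : L) * ((J k γ)⁻¹ : Lˣ) = 1 := Units.mul_inv _
  have e2 : γ • (J k γ' : L) * γ • (((J k γ')⁻¹ : Lˣ) * γ' • f) = γ • γ' • f := by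
    rw [← smul_mul', Units.mul_inv_cancel_left]
  calc (J k (γ * γ') : L) * (((J k (γ * γ'))⁻¹ : Lˣ) * (γ * γ') • f)
        = γ • γ' • f := by rw [Units.mul_inv_cancel_left, mul_smul]
    _ = ((J k γ : L) * ((J k γ)⁻¹ : Lˣ)) * (γ • (J k γ' : L) * γ • (((J k γ')⁻¹ : Lˣ) * γ' • f)) := by
          rw [e1, e2, one_mul]
    _ = (J k (γ * γ') : L) * (((J k γ)⁻¹ : Lˣ) * γ • (((J k γ')⁻¹ : Lˣ) * γ' • f)) := by
          rw [hJcoc]; ring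

/-- **Finite-index stabiliser for the slash action.** `G` a group acting on a commutative domain `L`
by ring automorphisms, `Γ ≤ G` of finite index, `J : 𝓦 → G → Lˣ` automorphy factors additive in
the weight and satisfying the cocycle identity. If `F_j` (`j ≤ D`) are modular of weight `b_j` for
`Γ`, `b_j + j • k = b_0`, some `F_j ≠ 0`, and `Σ_{j ≤ D} F_j g^j = 0`, then there is a finite-index
subgroup `H ≤ G` fixing `g` under the weight-`k` slash action `γ ⋆ g = (J k γ)⁻¹ · γ • g`: namely
the stabiliser `{γ ∈ Γ | γ ⋆ g = g}` (a subgroup by `transferAbs_slash_one`/`transferAbs_slash_mul`),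
whose left cosets in `Γ` inject via `[γ] ↦ γ ⋆ g` into the finite orbit of `stub_finiteSlashOrbit`. -/
theorem transferAbs_exists_finiteIndex {G L 𝓦 : Type*} [Group G] [CommRing L] [IsDomain L]
    [MulSemiringAction G L] [AddCommGroup 𝓦] (Γ : Subgroup G) (hΓ : Γ.FiniteIndex)
    (J : 𝓦 → G → Lˣ) (hJ : ∀ (b b' : 𝓦) (γ : G), J (b + b') γ = J b γ * J b' γ)
    (hJcoc : ∀ (b : 𝓦) (γ γ' : G), (J b (γ * γ') : L) = J b γ * γ • (J b γ' : L))
    (k : 𝓦) (D : ℕ) (b : ℕ → 𝓦) (hb : ∀ j ≤ D, b j + j • k = b 0)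
    (F : ℕ → L) (hF : ∀ j ≤ D, ∀ γ ∈ Γ, γ • F j = (J (b j) γ : L) * F j) (hF0 : ∃ j ≤ D, F j ≠ 0)
    (g : L) (hrel : ∑ j ∈ Finset.range (D + 1), F j * g ^ j = 0) :
    ∃ H : Subgroup G, H.FiniteIndex ∧ ∀ γ ∈ H, ((J k γ)⁻¹ : Lˣ) * γ • g = g := by
  classical
  -- the action laws of `γ ⋆ f := (J k γ)⁻¹ * γ • f`
  have h1 : ∀ f : L, ((J k 1)⁻¹ : Lˣ) * (1 : G) • f = f := transferAbs_slash_one J hJcoc k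
  have hmul : ∀ (γ γ' : G) (f : L), ((J k (γ * γ'))⁻¹ : Lˣ) * (γ * γ') • f
      = ((J k γ)⁻¹ : Lˣ) * γ • (((J k γ')⁻¹ : Lˣ) * γ' • f) := transferAbs_slash_mul J hJcoc k
  -- the stabiliser of `g` in `Γ`
  obtain ⟨H, hH⟩ : ∃ H : Subgroup G, ∀ γ, γ ∈ H ↔ γ ∈ Γ ∧ ((J k γ)⁻¹ : Lˣ) * γ • g = g :=
    ⟨{ carrier := {γ | γ ∈ Γ ∧ ((J k γ)⁻¹ : Lˣ) * γ • g = g}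
       mul_mem' := fun {γ γ'} hγ hγ' ↦ ⟨Γ.mul_mem hγ.1 hγ'.1, by rw [hmul, hγ'.2, hγ.2]⟩
       one_mem' := ⟨Γ.one_mem, h1 g⟩
       inv_mem' := fun {γ} hγ ↦ ⟨Γ.inv_mem hγ.1, by
         conv_lhs => rw [← hγ.2]
         rw [← hmul, inv_mul_cancel, h1]⟩ }, fun _ ↦ Iff.rfl⟩
  have hHΓ : H ≤ Γ := fun γ hγ ↦ ((hH γ).1 hγ).1
  -- `γ ⋆ g = γ' ⋆ g` forces `γ⁻¹ γ' ∈ H`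
  have hkey : ∀ γ ∈ Γ, ∀ γ' ∈ Γ,
      ((J k γ)⁻¹ : Lˣ) * γ • g = ((J k γ')⁻¹ : Lˣ) * γ' • g → γ⁻¹ * γ' ∈ H := by
    intro γ hγ γ' hγ' h
    refine (hH _).2 ⟨Γ.mul_mem (Γ.inv_mem hγ) hγ', ?_⟩
    rw [hmul, ← h, ← hmul, inv_mul_cancel, h1]
  -- the weight-`k` orbit of `g` under `Γ` is finite (S9)
  have hfin := stub_finiteSlashOrbit Γ J hJ k D b hb F hF hF0 g hrel
  -- `Γ ⧸ (H ⊓ Γ)` injects into the orbit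
  haveI hfq : Finite (Γ ⧸ H.subgroupOf Γ) := by
    let φ : Γ ⧸ H.subgroupOf Γ → L := fun q ↦ Quotient.liftOn' q
      (fun γ : Γ ↦ ((J k (γ : G))⁻¹ : Lˣ) * (γ : G) • g) (fun γ γ' hγγ' ↦ by
        rw [QuotientGroup.leftRel_apply, Subgroup.mem_subgroupOf] at hγγ'
        have h2 : ((J k ((γ : G)⁻¹ * γ'))⁻¹ : Lˣ) * ((γ : G)⁻¹ * γ') • g = g := ((hH _).1 hγγ').2
        show ((J k (γ : G))⁻¹ : Lˣ) * (γ : G) • g = ((J k (γ' : G))⁻¹ : Lˣ) * (γ' : G) • g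
        conv_lhs => rw [← h2]
        rw [← hmul, mul_inv_cancel_left])
    have hφ : Function.Injective φ := fun q₁ q₂ ↦
      Quotient.inductionOn₂' q₁ q₂ fun γ γ'
          (h : ((J k (γ : G))⁻¹ : Lˣ) * (γ : G) • g = ((J k (γ' : G))⁻¹ : Lˣ) * (γ' : G) • g) ↦
        Quotient.sound' <| by
          rw [QuotientGroup.leftRel_apply, Subgroup.mem_subgroupOf]
          exact hkey _ γ.2 _ γ'.2 h
    have hrange : Set.range φ ⊆ {x : L | ∃ γ ∈ Γ, x = ((J k γ)⁻¹ : Lˣ) * γ • g} := by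
      rintro _ ⟨q, rfl⟩
      induction q using Quotient.inductionOn' with
      | h γ => exact ⟨γ, γ.2, rfl⟩
    haveI : Finite (Set.range φ) := (hfin.subset hrange).to_subtype
    exact Finite.of_injective_finite_range hφ
  haveI : (H.subgroupOf Γ).FiniteIndex := Subgroup.finiteIndex_of_finite_quotient
  -- lift the finite index from `Γ` to `G`
  have hHfi : H.FiniteIndex := by
    refine ⟨?_⟩
    rw [← Subgroup.relIndex_mul_index hHΓ]
    exact mul_ne_zero (Subgroup.FiniteIndex.index_ne_zero (H := H.subgroupOf Γ)) hΓ.index_ne_zero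
  exact ⟨H, hHfi, fun γ hγ ↦ ((hH γ).1 hγ).2⟩

/-- **stub S12 — `stub_transferAbstract` (M; the TRANSFER half modulo vocabulary, principal component).**
Assume Serre's congruence subgroup property for `SL₂(𝓞_F)` (`hCSP`, the statement of stub 7), `F` totally
real with `[F:ℚ] ≥ 2`.  Let `SL₂(𝓞_F)` act on a commutative domain `L` by ring automorphisms, `Γ` a
finite-index subgroup, `J : 𝓦 → SL₂(𝓞_F) → Lˣ` automorphy factors additive in the weight and satisfying the
cocycle identity `J b (γγ') = J b γ · γ • J b γ'`.  If `F_j` (`j ≤ D`) are modular of weight `b_j` for `Γ`,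
`b_j + j • k = b_0`, some `F_j ≠ 0`, and `Σ_{j≤D} F_j g^j = 0`, then some principal congruence subgroup
`Γ(𝔪)`, `𝔪 ≠ 0`, fixes `g` under the weight-`k` action: `(J k γ)⁻¹ · γ • g = g` for all `γ ≡ 1 (mod 𝔪)`.
(S9 gives a finite orbit; the stabiliser `{γ ∈ Γ : γ ⋆ g = g}` is a subgroup by the cocycle identity and has
finite index by the coset injection into the orbit and `[SL₂(𝓞_F):Γ] < ∞`; then `hCSP`.) [folklore] -/
theorem stub_transferAbstract
    (hCSP : ∀ (F : Type) [Field F] [NumberField F] [NumberField.IsTotallyReal F],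
      1 < Module.finrank ℚ F →
      ∀ H : Subgroup (Matrix.SpecialLinearGroup (Fin 2) (NumberField.RingOfIntegers F)),
        H.FiniteIndex →
        ∃ 𝔪 : Ideal (NumberField.RingOfIntegers F), 𝔪 ≠ ⊥ ∧
          (Matrix.SpecialLinearGroup.map (Ideal.Quotient.mk 𝔪)).ker ≤ H)
    (F : Type) [Field F] [NumberField F] [NumberField.IsTotallyReal F] (hF : 1 < Module.finrank ℚ F)
    {L 𝓦 : Type*} [CommRing L] [IsDomain L] [AddCommGroup 𝓦]
    [MulSemiringAction (Matrix.SpecialLinearGroup (Fin 2) (NumberField.RingOfIntegers F)) L]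
    (Γ : Subgroup (Matrix.SpecialLinearGroup (Fin 2) (NumberField.RingOfIntegers F))) (hΓ : Γ.FiniteIndex)
    (J : 𝓦 → Matrix.SpecialLinearGroup (Fin 2) (NumberField.RingOfIntegers F) → Lˣ)
    (hJ : ∀ (b b' : 𝓦) (γ : Matrix.SpecialLinearGroup (Fin 2) (NumberField.RingOfIntegers F)),
      J (b + b') γ = J b γ * J b' γ)
    (hJcoc : ∀ (b : 𝓦) (γ γ' : Matrix.SpecialLinearGroup (Fin 2) (NumberField.RingOfIntegers F)),
      (J b (γ * γ') : L) = J b γ * γ • (J b γ' : L))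
    (k : 𝓦) (D : ℕ) (b : ℕ → 𝓦) (hb : ∀ j ≤ D, b j + j • k = b 0)
    (Fm : ℕ → L) (hFm : ∀ j ≤ D, ∀ γ ∈ Γ, γ • Fm j = (J (b j) γ : L) * Fm j) (hFm0 : ∃ j ≤ D, Fm j ≠ 0)
    (g : L) (hrel : ∑ j ∈ Finset.range (D + 1), Fm j * g ^ j = 0) :
    ∃ 𝔪 : Ideal (NumberField.RingOfIntegers F), 𝔪 ≠ ⊥ ∧
      ∀ γ ∈ (Matrix.SpecialLinearGroup.map (Ideal.Quotient.mk 𝔪)).ker, ((J k γ)⁻¹ : Lˣ) * γ • g = g := by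
  obtain ⟨H, hH, hHg⟩ :=
    transferAbs_exists_finiteIndex Γ hΓ J hJ hJcoc k D b hb Fm hFm hFm0 g hrel
  obtain ⟨𝔪, h𝔪, hle⟩ := hCSP F hF H hH
  exact ⟨𝔪, h𝔪, fun γ hγ ↦ hHg γ (hle hγ)⟩

end Summit.Langlands.Langlands.Theorems.HilbertIntegralOverconvergentIsCongruence
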